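import Literature.NumberTheory.Transcendental.ZeroEstMain
import HarnessLib

/-!
# Zero estimates on commutative algebraic groups: the degree-sensitive form of the main theorem

Topic `Literature/NumberTheory/Transcendental`. A strengthening of the tree's abstract zero
estimate `AnalyticGroupModel.zero_estimate` (`ZeroEstMain.lean`; D. Roy's exposition of
Philippon's Théorème 2.1, Nesterenko–Philippon (eds.), LNM 1752, Ch. 11, Thm. 4.1) in two
respects, both already present inside Roy's proof and merely exposed here:

* the **degree of the obstruction**: Roy's inequality (op. cit. Thm. 4.1) carries the factor
  `deg(σ + H₀)` of the translates of the obstructing subgroup, which `zero_estimate` replaces by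
  `1` (`ρ_Y ≥ 1`). We keep it, in the only form the abstract model can express it: a lower bound
  `ρ · binom(t - a + m₀, m₀) ≤ H_{𝔍(σ + H₀)}(t)` (`t ≥ a`, `m₀ = coneDim H₀`) for the cumulative
  Hilbert functions of the translates `σ + H₀`, `σ ∈ Σ`, supplied by the user for the subgroup
  `H₀` produced by the theorem, yields the factor `ρ` on the left-hand side;
* the **constant**: `zero_estimate` uses `M.hilbConst`, a non-effective constant extracted by
  choice from the Hilbert polynomial of `𝔊 = 𝔍(G)`; here any bound `H_𝔊(t) ≤ C_G (t+1)^{n+1}`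
  supplied by the user may be used instead, so that the constant of the estimate is
  `2^{(n+1)²} c^{n+1} C_G (n+1)!`, explicit in the data of the embedding.

Both refinements are needed when the single projective embedding is a Segre–Veronese
re-embedding of a product group with unbalanced partial degrees (the reduction of the
multihomogeneous case of Philippon's theorem to the homogeneous one): there `C_G` and the degrees
of the positive-dimensional obstructing subgroups grow with the Veronese degrees, and the estimate
is only useful if both are tracked.

## Contents (no definitions)

* `exists_ideal_hilbC_le_of_bound` — the lossy Bézout bound of `ZeroEstBezout.lean`
  (`exists_ideal_hilbC_le`) with `M.hilbConst` replaced by any `C_G` with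
  `H_𝔊(t) ≤ C_G (t+1)^{n+1}`;
* `zero_estimate_deg` — the zero estimate with the factor `ρ` and the constant
  `2^{(n+1)²} c^{n+1} C_G (n+1)!`.

## References

* Yu. V. Nesterenko, P. Philippon (eds.), *Introduction to Algebraic Independence Theory*,
  LNM 1752, Springer 2001, Ch. 11 (D. Roy), Thm. 4.1 and its proof (pp. 218–221). [NesterenkoPhilippon2001]
* P. Philippon, *Lemmes de zéros dans les groupes algébriques commutatifs*, Bull. Soc. Math.
  France 114 (1986), 355–383, Thm. 2.1. [Philippon1986]
-/

noncomputable section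

open MvPolynomial Set Module
open scoped Pointwise

namespace Literature.NumberTheory.Transcendental

namespace AnalyticGroupModel

variable {V : Type*} [NormedAddCommGroup V] [NormedSpace ℂ V] [CompleteSpace V] [FiniteDimensional ℂ V]
  {N : ℕ} (M : AnalyticGroupModel V N)

attribute [local instance] MvPolynomial.gradedAlgebra

/-! ### The lossy Bézout bound with an explicit Hilbert constant -/

section Chain

variable {ι : Type*} (𝔭 : ι → Ideal (MvPolynomial (Fin (N + 1)) ℂ)) (h𝔭 : ∀ i, (𝔭 i).IsPrime)
  (Fs : Finset (MvPolynomial (Fin (N + 1)) ℂ)) (r : ℕ) (hr : r ≤ M.dim + 1)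
  (hDH : ∀ 𝔭' : Ideal (MvPolynomial (Fin (N + 1)) ℂ), 𝔭'.IsPrime → (∃ i, 𝔭' ≤ 𝔭 i) →
    M.relIdeal ≤ 𝔭' → (↑Fs : Set (MvPolynomial (Fin (N + 1)) ℂ)) ⊆ 𝔭' →
    ringKrullDim (MvPolynomial (Fin (N + 1)) ℂ ⧸ 𝔭') ≤ ((M.dim + 1 - r : ℕ) : WithBot ℕ∞))

include hr hDH in
/-- **The lossy Bézout bound with an explicit constant**: as `exists_ideal_hilbC_le`, but with
`M.hilbConst` replaced by any `C_G` such that `H_𝔊(t) ≤ C_G (t+1)^{n+1}` for all `t`: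
there is `𝔍` with `𝔍 ≤ loc 𝔭ᵢ (𝔊 + (S))` for all `i` and
`H_𝔍(t) ≤ 2^{(n+1) r} δ^r C_G (t+1)^{n+1-r}`.
[cite: NesterenkoPhilippon2001, Ch. 11 Prop. 2.2 (lossy form)] -/
theorem exists_ideal_hilbC_le_of_bound [Fintype ι] [Nonempty ι]
    (hhom : ∀ i, (𝔭 i).IsHomogeneous (homogeneousSubmodule (Fin (N + 1)) ℂ))
    (h𝔊 : ∀ i, M.relIdeal ≤ 𝔭 i) (hrel : ∀ i, M.IsRelevant (𝔭 i)) {δ : ℕ}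
    (hFdeg : (↑Fs : Set (MvPolynomial (Fin (N + 1)) ℂ)) ⊆ (ZeroEst.Fil (N := N) δ : Set (MvPolynomial (Fin (N + 1)) ℂ)))
    (hF𝔭 : ∀ i, (↑Fs : Set (MvPolynomial (Fin (N + 1)) ℂ)) ⊆ (𝔭 i : Set (MvPolynomial (Fin (N + 1)) ℂ)))
    {C_G : ℕ} (hC : ∀ t, ZeroEst.hilbC (M.relIdeal.restrictScalars ℂ) t ≤ C_G * (t + 1) ^ (M.dim + 1)) :
    ∃ 𝔍 : Ideal (MvPolynomial (Fin (N + 1)) ℂ),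
      (∀ i, 𝔍 ≤ GaGm.loc (𝔭 i) (h𝔭 i) (M.relIdeal ⊔ Ideal.span (↑Fs : Set (MvPolynomial (Fin (N + 1)) ℂ)))) ∧
      ∀ t, ZeroEst.hilbC (𝔍.restrictScalars ℂ) t ≤
        2 ^ ((M.dim + 1) * r) * δ ^ r * C_G * (t + 1) ^ (M.dim + 1 - r) := by
  classical
  obtain ⟨Qs, hlen, hspan, hav⟩ := M.exists_list_avoids 𝔭 Fs r hr hDH r le_rfl
  have hspanFil : Submodule.span ℂ (↑Fs : Set (MvPolynomial (Fin (N + 1)) ℂ)) ≤ ZeroEst.Fil (N := N) δ :=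
    Submodule.span_le.mpr hFdeg
  have hspan𝔭 : ∀ i, Submodule.span ℂ (↑Fs : Set (MvPolynomial (Fin (N + 1)) ℂ)) ≤ (𝔭 i).restrictScalars ℂ :=
    fun i => Submodule.span_le.mpr (hF𝔭 i)
  have hspanI : Submodule.span ℂ (↑Fs : Set (MvPolynomial (Fin (N + 1)) ℂ)) ≤
      (Ideal.span (↑Fs : Set (MvPolynomial (Fin (N + 1)) ℂ))).restrictScalars ℂ :=
    Submodule.span_le.mpr fun x hx => Ideal.subset_span hx
  have hofList : ∀ L : List (MvPolynomial (Fin (N + 1)) ℂ), (∀ Q ∈ L, Q ∈ Qs) →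
      ∀ i, M.relIdeal ⊔ Ideal.ofList L ≤ 𝔭 i := fun L hL i => by
    refine sup_le (h𝔊 i) ?_
    rw [Ideal.ofList, Ideal.span_le]
    intro Q hQ
    exact hspan𝔭 i (hspan Q (hL Q hQ))
  -- the chain
  let 𝔍 : ℕ → Ideal (MvPolynomial (Fin (N + 1)) ℂ) := fun j =>
    Finset.univ.inf fun i => GaGm.loc (𝔭 i) (h𝔭 i) (M.relIdeal ⊔ Ideal.ofList (Qs.take j))
  let Q : ℕ → MvPolynomial (Fin (N + 1)) ℂ := fun j => Qs.getD (j - 1) 0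
  have hQmem : ∀ j < r, Q (j + 1) ∈ Qs := fun j hj => by
    simp only [Q, Nat.add_sub_cancel]
    rw [List.getD_eq_getElem _ _ (by omega)]
    exact List.getElem_mem _
  have hdec : ∀ j < r, Qs = Qs.take j ++ Q (j + 1) :: Qs.drop (j + 1) := fun j hj => by
    simp only [Q, Nat.add_sub_cancel]
    rw [List.getD_eq_getElem _ _ (by omega), ← List.drop_eq_getElem_cons (by omega), List.take_append_drop]
  -- `𝔍 0 = 𝔊`
  have hloc𝔊 : ∀ i, GaGm.loc (𝔭 i) (h𝔭 i) M.relIdeal = M.relIdeal := fun i => by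
    refine le_antisymm (fun g ⟨P, hP, hPg⟩ => ?_) (GaGm.le_loc (h𝔭 i) _)
    exact (M.isPrime_relIdeal.mem_or_mem hPg).resolve_left fun h => hP (h𝔊 i h)
  have h0 : 𝔍 0 = M.relIdeal := by
    show Finset.univ.inf (fun i => GaGm.loc (𝔭 i) (h𝔭 i) (M.relIdeal ⊔ Ideal.ofList (Qs.take 0))) = M.relIdeal
    simp only [List.take_zero, Ideal.ofList_nil, sup_bot_eq, hloc𝔊]
    exact Finset.inf_const Finset.univ_nonempty _
  have hne : ∀ j < r, 𝔍 j ≠ ⊤ := fun j hj htop => by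
    obtain ⟨i⟩ := ‹Nonempty ι›
    have h1 : 𝔍 j ≤ 𝔭 i := (Finset.inf_le (Finset.mem_univ i)).trans
      (GaGm.loc_le (h𝔭 i) (hofList _ (fun Q hQ => List.mem_of_mem_take hQ) i))
    exact (h𝔭 i).ne_top (top_le_iff.mp (htop ▸ h1))
  have hQB : ∀ j < r, Q (j + 1) ∈ ZeroEst.Fil (N := N) δ := fun j hj => hspanFil (hspan _ (hQmem j hj))
  have hQnzd : ∀ j < r, GaGm.IsNZDMod (𝔍 j) (Q (j + 1)) := fun j hj =>
    GaGm.isNZDMod_finsetInf _ _ fun i _ =>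
      M.isNZDMod_loc_ofList (h𝔭 i) (hhom i) (h𝔊 i) (hrel i) (fun q hq => hspan𝔭 i (hspan q hq)) (hav i) (hdec j hj)
  have hstep : ∀ j < r, 𝔍 j ⊔ Ideal.span {Q (j + 1)} ≤ 𝔍 (j + 1) := fun j hj => by
    have htake : Qs.take (j + 1) = Qs.take j ++ [Q (j + 1)] := by
      simp only [Q, Nat.add_sub_cancel]
      rw [List.getD_eq_getElem _ _ (by omega), List.take_succ_eq_append_getElem (by omega)]
    refine Finset.le_inf fun i _ => sup_le ((Finset.inf_le (Finset.mem_univ i)).trans (GaGm.loc_mono (h𝔭 i) ?_)) ?_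
    · rw [htake, Ideal.ofList_append]
      exact sup_le_sup_left le_sup_left _
    · rw [Ideal.span_singleton_le_iff_mem]
      refine GaGm.le_loc (h𝔭 i) _ ?_
      rw [htake, Ideal.ofList_append, Ideal.ofList_singleton]
      exact Ideal.mem_sup_right (Ideal.mem_sup_right (Ideal.mem_span_singleton_self _))
  have h0bd : ∀ t, ZeroEst.hilbC ((𝔍 0).restrictScalars ℂ) t ≤ C_G * (t + 1) ^ (M.dim + 1) := fun t => by
    rw [h0]; exact hC t
  have hbound := ZeroEst.hilbC_chain_le 𝔍 Q r (M.dim + 1) C_G δ h0bd hne hQB hQnzd hstep r le_rfl hr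
  refine ⟨𝔍 r, fun i => (Finset.inf_le (Finset.mem_univ i)).trans (GaGm.loc_mono (h𝔭 i) ?_), hbound⟩
  refine sup_le_sup_left ?_ _
  rw [List.take_of_length_le (by omega), Ideal.ofList, Ideal.span_le]
  intro q hq
  exact hspanI (hspan q hq)
end Chain

/-! ### The zero estimate, degree-sensitive form -/

/-- **Philippon's zero estimate for an analytic group model, degree-sensitive form** (Roy's
Thm. 4.1 with the factor `deg(σ + H₀)` kept as a user-supplied lower bound `ρ` for the cumulative
Hilbert functions of the translates of the obstruction, and an explicit Hilbert constant `C_G`):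
for every subspace `W ⊆ V`, every finite `Σ ∋ 0`, every form `P` of degree `D` with `F_P ≢ 0`
vanishing to order `> nT` along `W` at the points of `Σ(n)`, there is a closed irreducible
subgroup `H₀` and `v₀` with `F_P(v₀ + H₀) = 0` such that, for every `ρ` with
`ρ · binom(t - a_σ + m₀, m₀) ≤ H_{𝔍(σ + H₀)}(t)` (`t ≥ a_σ`, all `σ ∈ Σ`, `m₀ = coneDim H₀`),
`binom(T + s, s) · card{σ + H₀} · ρ · D^{m₀ - 1} ≤ 2^{(n+1)²} c^{n+1} C_G (n+1)! · Dⁿ`.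
[cite: NesterenkoPhilippon2001, Ch. 11 Thm. 4.1] [cite: Philippon1986, Thm. 2.1] -/
theorem zero_estimate_deg (W : Submodule ℂ V) {S : Set V} (hSfin : S.Finite) (h0 : (0 : V) ∈ S)
    {P : MvPolynomial (Fin (N + 1)) ℂ} {D T : ℕ} (hP : P.IsHomogeneous D) (hP0 : ∃ w, M.F P w ≠ 0)
    (hvan : ∀ σ ∈ sumset S M.dim, VanishesToOrder W (M.F P) σ (M.dim * T + 1))
    {C_G : ℕ} (hC : ∀ t, ZeroEst.hilbC (M.relIdeal.restrictScalars ℂ) t ≤ C_G * (t + 1) ^ (M.dim + 1)) :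
    ∃ H₀ : AddSubgroup V, M.IsClosedG (H₀ : Set V) ∧ M.IsIrred (H₀ : Set V) ∧
      (∃ v₀, ∀ h ∈ H₀, M.F P (v₀ + h) = 0) ∧
      ∀ ρ : ℕ, (∀ σ ∈ S, ∃ a : ℕ, ∀ t, a ≤ t →
          ρ * (t - a + M.coneDim ((H₀ : AddSubgroup V) : Set V)).choose (M.coneDim ((H₀ : AddSubgroup V) : Set V)) ≤
            ZeroEst.hilbC (N := N) ((M.vanishing (σ +ᵥ ((H₀ : AddSubgroup V) : Set V))).restrictScalars ℂ) t) →
      (T + (finrank ℂ W - finrank ℂ ↥(W ⊓ linSpace ((H₀ : AddSubgroup V) : Set V)))).choose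
          (finrank ℂ W - finrank ℂ ↥(W ⊓ linSpace ((H₀ : AddSubgroup V) : Set V))) *
        ((fun σ => σ +ᵥ ((H₀ : AddSubgroup V) : Set V)) '' S).ncard * ρ *
        D ^ (M.coneDim ((H₀ : AddSubgroup V) : Set V) - 1) ≤
        2 ^ ((M.dim + 1) * (M.dim + 1)) * M.lawDeg ^ (M.dim + 1) * C_G * (M.dim + 1).factorial * D ^ M.dim := by
  classical
  have hc : 1 ≤ M.lawDeg := M.lawDeg_pos
  set n := M.dim with hn
  obtain ⟨St, hStcl, Γ, k, v₀, hzero, hSE, hH₀St, hcosE, hdimcos, hdT, hdimEn, hdimEH⟩ :=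
    M.exists_descent_data W h0 T hP hP0 hvan
  set H₀ : AddSubgroup V := M.idComp St hStcl with hH₀
  set 𝔄 := M.dIdeal W P Γ (k * T) with h𝔄
  set E := M.zeroSet (𝔄 : Set (MvPolynomial (Fin (N + 1)) ℂ)) with hE
  have hirr : M.IsIrred ((H₀ : AddSubgroup V) : Set V) := M.isIrred_idComp St hStcl
  set s := finrank ℂ W - finrank ℂ ↥(W ⊓ linSpace ((H₀ : AddSubgroup V) : Set V)) with hs
  set m₀ := M.coneDim ((H₀ : AddSubgroup V) : Set V) with hm₀
  refine ⟨H₀, hirr.isClosedG, hirr, ⟨v₀, hzero⟩, fun ρ hρ => ?_⟩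
  -- basic facts on `𝔄` and `E`
  have h𝔄hom : 𝔄.IsHomogeneous (homogeneousSubmodule (Fin (N + 1)) ℂ) := M.isHomogeneous_dIdeal hP Γ (k * T)
  have h𝔊𝔄 : M.relIdeal ≤ 𝔄 := M.relIdeal_le_dIdeal P Γ (k * T)
  have h𝔄spec : M.specialClosure 𝔄 = 𝔄 := M.specialClosure_dIdeal P Γ (k * T)
  have hEcl : M.IsClosedG E := M.isClosedG_zeroSet _
  have h𝔄E : 𝔄 ≤ M.vanishing E := fun f hf => M.subset_vanishing_zeroSet _ hf
  -- `𝔍(E) = √𝔄`: all minimal primes of the special ideal `𝔄` are relevant homogeneous primes `⊇ 𝔊`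
  have hminrel : ∀ 𝔮 ∈ 𝔄.minimalPrimes, M.IsRelevant 𝔮 := fun 𝔮 h𝔮 => by
    rw [← h𝔄spec] at h𝔮; exact M.isRelevant_of_mem_minimalPrimes_specialClosure h𝔮
  have hvanE : M.vanishing E = 𝔄.radical := by
    refine le_antisymm ?_ ?_
    · rw [← Ideal.sInf_minimalPrimes]
      refine le_sInf fun 𝔮 h𝔮 => ?_
      haveI := h𝔮.1.1
      have hq := M.vanishing_zeroSet_eq_of_isPrime (𝔭 := 𝔮)
        (Literature.RingTheory.MvPolynomial.isHomogeneous_of_mem_minimalPrimes h𝔄hom h𝔮)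
        (h𝔊𝔄.trans h𝔮.1.2) (hminrel 𝔮 h𝔮)
      rw [← hq]
      exact M.vanishing_antitone (M.zeroSet_antitone h𝔮.1.2)
    · exact (M.isRadical_vanishing E).radical_le_iff.mpr h𝔄E
  -- the cosets `σ + H₀`, `σ ∈ Σ`
  set 𝓨 : Finset (Set V) := hSfin.toFinset.image fun σ => σ +ᵥ ((H₀ : AddSubgroup V) : Set V) with h𝓨
  have hrep : ∀ Y ∈ 𝓨, ∃ σ ∈ S, Y = σ +ᵥ ((H₀ : AddSubgroup V) : Set V) := fun Y hY => by
    rw [h𝓨, Finset.mem_image] at hY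
    obtain ⟨σ, hσ, rfl⟩ := hY
    exact ⟨σ, hSfin.mem_toFinset.mp hσ, rfl⟩
  choose! rep hrepS hrepY using hrep
  have h0𝓨 : (0 : V) +ᵥ ((H₀ : AddSubgroup V) : Set V) ∈ 𝓨 := by
    rw [h𝓨, Finset.mem_image]; exact ⟨0, hSfin.mem_toFinset.mpr h0, rfl⟩
  haveI : Nonempty ↥𝓨 := ⟨⟨_, h0𝓨⟩⟩
  have hYirr : ∀ Y : ↥𝓨, M.IsIrred (Y : Set V) := fun Y => by rw [hrepY Y Y.2]; exact hirr.vadd M _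
  have hYE : ∀ Y : ↥𝓨, (Y : Set V) ⊆ E := fun Y => by rw [hrepY Y Y.2]; exact hcosE _ (hrepS Y Y.2)
  have hYdim : ∀ Y : ↥𝓨, M.coneDim (Y : Set V) = m₀ := fun Y => by
    rw [hrepY Y Y.2, hdimcos _ (hrepS Y Y.2), hdimEH]
  have hYdT : ∀ Y : ↥𝓨, ∀ a ∈ (Y : Set V), ∀ Q ∈ 𝔄, VanishesToOrder W (M.F Q) a (T + 1) := by
    intro Y a ha Q hQ
    rw [hrepY Y Y.2] at ha
    obtain ⟨h, hh, rfl⟩ := ha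
    exact hdT _ (hrepS Y Y.2) h (hH₀St hh) Q hQ
  -- the primes
  set 𝔭 : ↥𝓨 → Ideal (MvPolynomial (Fin (N + 1)) ℂ) := fun Y => M.vanishing (Y : Set V) with h𝔭
  have h𝔭p : ∀ Y, (𝔭 Y).IsPrime := fun Y => (hYirr Y).isPrime
  have h𝔭hom : ∀ Y, (𝔭 Y).IsHomogeneous (homogeneousSubmodule (Fin (N + 1)) ℂ) := fun Y => M.isHomogeneous_vanishing _
  have h𝔭𝔊 : ∀ Y, M.relIdeal ≤ 𝔭 Y := fun Y => M.vanishing_antitone (subset_univ _)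
  have h𝔭rel : ∀ Y, M.IsRelevant (𝔭 Y) := fun Y => M.isRelevant_vanishing (hYirr Y).nonempty
  have h𝔄le : ∀ Y, 𝔄 ≤ 𝔭 Y := fun Y => fun f hf => M.vanishing_antitone (hYE Y) (h𝔄E hf)
  have hYZ : ∀ Y : ↥𝓨, M.zeroSet ((𝔭 Y : Ideal _) : Set (MvPolynomial (Fin (N + 1)) ℂ)) = (Y : Set V) :=
    fun Y => (hYirr Y).isClosedG.eq
  have hmin : ∀ Y, 𝔭 Y ∈ 𝔄.minimalPrimes := fun Y => by
    obtain ⟨𝔮, h𝔮, hYeq, hv⟩ := (hYirr Y).exists_eq_zeroSet_minimalPrimes M hEcl (hYE Y) (by rw [hYdim, ← hdimEH])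
    rw [← Ideal.radical_minimalPrimes, ← hvanE, show 𝔭 Y = 𝔮 from hv]
    exact h𝔮
  have hrad : ∀ Y, ∃ Mm : ℕ, 𝔭 Y ^ Mm ≤ GaGm.loc (𝔭 Y) (h𝔭p Y) 𝔄 := fun Y =>
    GaGm.exists_pow_le_loc_of_mem_minimalPrimes (hmin Y)
  have hinc : ∀ Y Y' : ↥𝓨, 𝔭 Y ≤ 𝔭 Y' → Y = Y' := fun Y Y' hle => by
    have hsub : (Y' : Set V) ⊆ Y := by
      rw [← (hYirr Y').isClosedG.eq, ← (hYirr Y).isClosedG.eq]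
      exact M.zeroSet_antitone hle
    have heq := (hYirr Y).eq_of_subset_of_coneDim_eq M (hYirr Y').isClosedG (hYirr Y').nonempty hsub
      (by rw [hYdim, hYdim])
    exact Subtype.ext heq.symm
  -- the multiplicity estimate at each coset
  have hcount : ∀ Y : ↥𝓨, ∃ cY : ℕ, ∀ t,
      (T + s).choose s * ZeroEst.hilbC ((𝔭 Y).restrictScalars ℂ) t ≤
        ZeroEst.hilbC (N := N) ((GaGm.loc (𝔭 Y) (h𝔭p Y) 𝔄).restrictScalars ℂ) (t + cY * T) := by
    intro Y
    have eY : M.zeroSet ((𝔭 Y : Ideal _) : Set (MvPolynomial (Fin (N + 1)) ℂ)) = rep Y +ᵥ ((H₀ : AddSubgroup V) : Set V) :=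
      (hYZ Y).trans (hrepY Y Y.2)
    have hσY : rep Y ∈ M.zeroSet ((𝔭 Y : Ideal _) : Set (MvPolynomial (Fin (N + 1)) ℂ)) := by
      rw [eY]; exact ⟨0, H₀.zero_mem, (vadd_eq_add _ _).trans (add_zero _)⟩
    have hstab : ∀ w ∈ M.zeroSet ((𝔭 Y : Ideal _) : Set (MvPolynomial (Fin (N + 1)) ℂ)),
        ∀ v ∈ M.zeroSet ((𝔭 Y : Ideal _) : Set (MvPolynomial (Fin (N + 1)) ℂ)),
          v + (w - rep Y) ∈ M.zeroSet ((𝔭 Y : Ideal _) : Set (MvPolynomial (Fin (N + 1)) ℂ)) := by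
      intro w hw v hv
      rw [eY] at hw hv ⊢
      obtain ⟨h₁, hh₁, rfl⟩ := hw
      obtain ⟨h₂, hh₂, rfl⟩ := hv
      refine ⟨h₂ + h₁, H₀.add_mem hh₂ hh₁, ?_⟩
      simp only [vadd_eq_add]; abel
    have hlin : linSpace (M.zeroSet ((𝔭 Y : Ideal _) : Set (MvPolynomial (Fin (N + 1)) ℂ))) =
        linSpace ((H₀ : AddSubgroup V) : Set V) := by
      rw [eY, linSpace_vadd]
    have hvanY : ∀ Q ∈ 𝔄, ∀ a ∈ M.zeroSet ((𝔭 Y : Ideal _) : Set (MvPolynomial (Fin (N + 1)) ℂ)),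
        VanishesToOrder W (M.F Q) a (T + 1) := fun Q hQ a ha => hYdT Y a (by rwa [hYZ] at ha) Q hQ
    obtain ⟨cY, hcY⟩ := M.coset_multiplicity (W := W) (h𝔭p Y) (h𝔭hom Y) (h𝔭𝔊 Y) (h𝔭rel Y) h𝔄hom hσY hstab hvanY
    refine ⟨cY, fun t => ?_⟩
    have := hcY t
    rwa [hlin] at this
  choose cY hcY using hcount
  -- the lower bound for the Hilbert function of each coset prime (hypothesis `hρ`)
  have hsand : ∀ Y : ↥𝓨, ∃ a : ℕ, ∀ t, a ≤ t →
      ρ * (t - a + m₀).choose m₀ ≤ ZeroEst.hilbC (N := N) ((𝔭 Y).restrictScalars ℂ) t := by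
    intro Y
    obtain ⟨a, ha⟩ := hρ (rep Y) (hrepS Y Y.2)
    refine ⟨a, fun t ht => ?_⟩
    have h := ha t ht
    have hY : (𝔭 Y) = M.vanishing (rep Y +ᵥ ((H₀ : AddSubgroup V) : Set V)) := by
      simp only [h𝔭]; rw [← hrepY Y Y.2]
    rw [hY]
    exact h
  choose aY haY using hsand
  -- thick additivity
  obtain ⟨δ, hδ⟩ := ZeroEst.exists_sum_hilbC_loc_le 𝔄 𝔭 h𝔭p hinc h𝔄le hrad Finset.univ
  -- the generators in degree `cD` and the lossy Bézout bound
  obtain ⟨Fs, hFsF, hspanFs⟩ := M.exists_finset_span_eq W hP Γ (k * T)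
  have hFgen𝔄 : M.derivGens W P Γ (k * T) ⊆ (𝔄 : Set (MvPolynomial (Fin (N + 1)) ℂ)) := M.derivGens_subset_dIdeal P Γ (k * T)
  have hspanFs𝔄 : M.relIdeal ⊔ Ideal.span (↑Fs : Set (MvPolynomial (Fin (N + 1)) ℂ)) ≤ 𝔄 :=
    sup_le h𝔊𝔄 (Ideal.span_le.mpr (hFsF.trans hFgen𝔄))
  -- `𝔄 = (𝔊 + (Fs))^*`
  have h𝔄eq : 𝔄 = M.specialClosure (M.relIdeal ⊔ Ideal.span (↑Fs : Set (MvPolynomial (Fin (N + 1)) ℂ))) := by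
    refine le_antisymm ?_ (by rw [← h𝔄spec]; exact M.specialClosure_mono hspanFs𝔄)
    rw [h𝔄, dIdeal]
    refine M.specialClosure_mono (sup_le_sup_left ?_ _)
    rw [Ideal.span_le]
    intro f hf
    have : f ∈ Submodule.span ℂ (M.derivGens W P Γ (k * T)) := Submodule.subset_span hf
    rw [← hspanFs] at this
    exact (Submodule.span_le.mpr (fun g hg => Ideal.subset_span hg) : Submodule.span ℂ (↑Fs : Set _) ≤
      (Ideal.span (↑Fs : Set (MvPolynomial (Fin (N + 1)) ℂ))).restrictScalars ℂ) this
  have hm₀le : m₀ ≤ n := by rw [← hdimEH]; exact hdimEn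
  have hm₀pos : 1 ≤ m₀ := M.one_le_coneDim hirr.nonempty
  set r' := n + 1 - m₀ with hr'
  have hr'le : r' ≤ n + 1 := Nat.sub_le _ _
  have hDH : ∀ 𝔭' : Ideal (MvPolynomial (Fin (N + 1)) ℂ), 𝔭'.IsPrime → (∃ Y, 𝔭' ≤ 𝔭 Y) →
      M.relIdeal ≤ 𝔭' → (↑Fs : Set (MvPolynomial (Fin (N + 1)) ℂ)) ⊆ 𝔭' →
      ringKrullDim (MvPolynomial (Fin (N + 1)) ℂ ⧸ 𝔭') ≤ ((n + 1 - r' : ℕ) : WithBot ℕ∞) := by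
    rintro 𝔭' h𝔭' ⟨Y, hle⟩ h𝔊' hFs
    -- pass to the homogeneous core `𝔭'* ⊆ 𝔭'`, a relevant homogeneous prime containing `𝔊 + (Fs)`
    haveI := h𝔭'
    set 𝔠 : Ideal (MvPolynomial (Fin (N + 1)) ℂ) := (𝔭'.homogeneousCore (homogeneousSubmodule (Fin (N + 1)) ℂ)).toIdeal with h𝔠
    haveI h𝔠p : 𝔠.IsPrime := h𝔭'.homogeneousCore
    have h𝔠le : 𝔠 ≤ 𝔭' := Ideal.toIdeal_homogeneousCore_le _ 𝔭'
    have h𝔠hom : 𝔠.IsHomogeneous (homogeneousSubmodule (Fin (N + 1)) ℂ) := (𝔭'.homogeneousCore _).isHomogeneous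
    have h𝔊𝔠 : M.relIdeal ≤ 𝔠 :=
      M.isHomogeneous_relIdeal.toIdeal_homogeneousCore_eq_self.symm.trans_le (Ideal.homogeneousCore_mono _ h𝔊')
    have hFs𝔠 : M.relIdeal ⊔ Ideal.span (↑Fs : Set (MvPolynomial (Fin (N + 1)) ℂ)) ≤ 𝔠 := by
      have hhomJ : (M.relIdeal ⊔ Ideal.span (↑Fs : Set (MvPolynomial (Fin (N + 1)) ℂ))).IsHomogeneous
          (homogeneousSubmodule (Fin (N + 1)) ℂ) :=
        Ideal.IsHomogeneous.sup M.isHomogeneous_relIdeal (Ideal.homogeneous_span _ _ fun f hf =>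
          ⟨_, M.isHomogeneous_of_mem_derivGens hP (hFsF hf)⟩)
      have hJle : M.relIdeal ⊔ Ideal.span (↑Fs : Set (MvPolynomial (Fin (N + 1)) ℂ)) ≤ 𝔭' :=
        sup_le h𝔊' (Ideal.span_le.mpr hFs)
      exact hhomJ.toIdeal_homogeneousCore_eq_self.symm.trans_le (Ideal.homogeneousCore_mono _ hJle)
    have h𝔠rel : M.IsRelevant 𝔠 := by
      obtain ⟨u, hu, hu𝔭⟩ := h𝔭rel Y
      exact ⟨u, hu, fun h => hu𝔭 (hle (h𝔠le h))⟩
    -- `Z_G(𝔠) ⊆ Z_G(𝔊 + (Fs)) = Z_G(𝔄) = E`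
    have hZ : M.zeroSet ((𝔠 : Ideal _) : Set (MvPolynomial (Fin (N + 1)) ℂ)) ⊆ E := by
      rw [hE, h𝔄eq, zeroSet_specialClosure]
      exact M.zeroSet_antitone hFs𝔠
    have hdim𝔠 : M.coneDim (M.zeroSet ((𝔠 : Ideal _) : Set (MvPolynomial (Fin (N + 1)) ℂ))) ≤ m₀ := by
      rw [← hdimEH]; exact M.coneDim_mono hZ
    have hne : (M.zeroSet ((𝔠 : Ideal _) : Set (MvPolynomial (Fin (N + 1)) ℂ))).Nonempty :=
      M.zeroSet_nonempty_of_isRelevant h𝔠hom h𝔊𝔠 h𝔠rel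
    have hv𝔠 : M.vanishing (M.zeroSet ((𝔠 : Ideal _) : Set (MvPolynomial (Fin (N + 1)) ℂ))) = 𝔠 :=
      M.vanishing_zeroSet_eq_of_isPrime h𝔠hom h𝔊𝔠 h𝔠rel
    have hdimeq := M.coneDim_eq hne
    rw [hv𝔠] at hdimeq
    calc ringKrullDim (MvPolynomial (Fin (N + 1)) ℂ ⧸ 𝔭')
        ≤ ringKrullDim (MvPolynomial (Fin (N + 1)) ℂ ⧸ 𝔠) :=
          ringKrullDim_le_of_surjective (Ideal.Quotient.factor h𝔠le) (Ideal.Quotient.factor_surjective _)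
      _ = M.coneDim (M.zeroSet ((𝔠 : Ideal _) : Set (MvPolynomial (Fin (N + 1)) ℂ))) := hdimeq.symm
      _ ≤ ((n + 1 - r' : ℕ) : WithBot ℕ∞) := by
          have : M.coneDim (M.zeroSet ((𝔠 : Ideal _) : Set (MvPolynomial (Fin (N + 1)) ℂ))) ≤ n + 1 - r' := by omega
          exact_mod_cast this
  have hFdeg : (↑Fs : Set (MvPolynomial (Fin (N + 1)) ℂ)) ⊆ (ZeroEst.Fil (N := N) (M.lawDeg * D) : Set (MvPolynomial (Fin (N + 1)) ℂ)) := by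
    intro f hf
    have hf' := M.isHomogeneous_of_mem_derivGens hP (hFsF hf)
    rw [SetLike.mem_coe, ZeroEst.mem_Fil]
    by_cases h0 : f = 0
    · rw [h0, totalDegree_zero]; exact Nat.zero_le _
    · rw [hf'.totalDegree h0]
  obtain ⟨𝔍, h𝔍le, h𝔍bd⟩ := M.exists_ideal_hilbC_le_of_bound 𝔭 h𝔭p Fs r' hr'le hDH h𝔭hom h𝔭𝔊 h𝔭rel hFdeg
    (fun Y => (hFsF.trans hFgen𝔄).trans (h𝔄le Y)) hC
  have h𝔍𝔮 : 𝔍 ≤ Finset.univ.inf fun Y => GaGm.loc (𝔭 Y) (h𝔭p Y) 𝔄 :=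
    Finset.le_inf fun Y _ => (h𝔍le Y).trans (GaGm.loc_mono (h𝔭p Y) hspanFs𝔄)
  -- the comparison of leading coefficients
  set Kb := 2 ^ ((n + 1) * r') * (M.lawDeg * D) ^ r' * C_G with hKb
  have hexp : n + 1 - r' = m₀ := by omega
  have hmain : ∀ t, δ + Finset.univ.sup (fun Y => cY Y * T + aY Y) ≤ t →
      ∑ Y ∈ (Finset.univ : Finset ↥𝓨), ((T + s).choose s * ρ) * (t - (δ + cY Y * T + aY Y) + m₀).choose m₀ ≤
        (Kb * m₀.factorial) * (t + 0 + m₀).choose m₀ := by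
    intro t ht
    have hY : ∀ Y : ↥𝓨, cY Y * T + aY Y ≤ Finset.univ.sup (fun Y => cY Y * T + aY Y) := fun Y =>
      Finset.le_sup (f := fun Y => cY Y * T + aY Y) (Finset.mem_univ Y)
    calc ∑ Y ∈ (Finset.univ : Finset ↥𝓨), ((T + s).choose s * ρ) * (t - (δ + cY Y * T + aY Y) + m₀).choose m₀
        ≤ ∑ Y ∈ (Finset.univ : Finset ↥𝓨), ZeroEst.hilbC (N := N) ((GaGm.loc (𝔭 Y) (h𝔭p Y) 𝔄).restrictScalars ℂ) (t - δ) := by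
          refine Finset.sum_le_sum fun Y _ => ?_
          have h1 := haY Y (t - δ - cY Y * T) (by have := hY Y; omega)
          have h2 := hcY Y (t - δ - cY Y * T)
          have e1 : t - δ - cY Y * T - aY Y = t - (δ + cY Y * T + aY Y) := by omega
          have e2 : t - δ - cY Y * T + cY Y * T = t - δ := by have := hY Y; omega
          rw [e1] at h1
          rw [e2] at h2
          calc (T + s).choose s * ρ * (t - (δ + cY Y * T + aY Y) + m₀).choose m₀
              = (T + s).choose s * (ρ * (t - (δ + cY Y * T + aY Y) + m₀).choose m₀) := by ring
            _ ≤ (T + s).choose s * ZeroEst.hilbC (N := N) ((𝔭 Y).restrictScalars ℂ) (t - δ - cY Y * T) :=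
                Nat.mul_le_mul_left _ h1
            _ ≤ _ := h2
      _ ≤ ZeroEst.hilbC (N := N) ((Finset.univ.inf fun Y => GaGm.loc (𝔭 Y) (h𝔭p Y) 𝔄).restrictScalars ℂ) t := hδ t (by omega)
      _ ≤ ZeroEst.hilbC (N := N) (𝔍.restrictScalars ℂ) t := ZeroEst.hilbC_antitone (fun x hx => h𝔍𝔮 hx) t
      _ ≤ Kb * (t + 1) ^ (n + 1 - r') := h𝔍bd t
      _ = Kb * (t + 1) ^ m₀ := by rw [hexp]
      _ ≤ Kb * (m₀.factorial * (t + m₀).choose m₀) := Nat.mul_le_mul_left _ (GaGm.pow_succ_le_factorial_mul_choose t m₀)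
      _ = (Kb * m₀.factorial) * (t + 0 + m₀).choose m₀ := by rw [Nat.add_zero]; ring
  have hsum := GaGm.Asymp.sum_le_of_choose_ineq (Finset.univ : Finset ↥𝓨) (Kb * m₀.factorial)
    (fun Y => (T + s).choose s * ρ) (fun Y => δ + cY Y * T + aY Y) 0 m₀ _ hmain
  -- `card 𝓨 · binom · ρ = ∑_Y binom ρ`
  have hcard : 𝓨.card * ((T + s).choose s * ρ) = ∑ Y ∈ (Finset.univ : Finset ↥𝓨), (T + s).choose s * ρ := by
    rw [Finset.sum_const, smul_eq_mul, Finset.card_univ, Fintype.card_coe]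
  have hncard : ((fun σ => σ +ᵥ ((H₀ : AddSubgroup V) : Set V)) '' S).ncard = 𝓨.card := by
    rw [show (fun σ => σ +ᵥ ((H₀ : AddSubgroup V) : Set V)) '' S = ↑𝓨 by
      rw [h𝓨, Finset.coe_image, hSfin.coe_toFinset], Set.ncard_coe_finset]
  -- the constant
  have hconst : Kb * m₀.factorial * D ^ (m₀ - 1) ≤
      2 ^ ((n + 1) * (n + 1)) * M.lawDeg ^ (n + 1) * C_G * (n + 1).factorial * D ^ n := by
    have h1 : m₀.factorial ≤ (n + 1).factorial := Nat.factorial_le (by omega)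
    have h2 : 2 ^ ((n + 1) * r') ≤ 2 ^ ((n + 1) * (n + 1)) := Nat.pow_le_pow_right (by norm_num) (Nat.mul_le_mul_left _ hr'le)
    have h3 : M.lawDeg ^ r' ≤ M.lawDeg ^ (n + 1) := Nat.pow_le_pow_right hc hr'le
    have h4 : D ^ r' * D ^ (m₀ - 1) = D ^ n := by rw [← pow_add]; congr 1; omega
    calc Kb * m₀.factorial * D ^ (m₀ - 1)
        = 2 ^ ((n + 1) * r') * M.lawDeg ^ r' * C_G * m₀.factorial * (D ^ r' * D ^ (m₀ - 1)) := by
          rw [hKb, mul_pow]; ring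
      _ ≤ 2 ^ ((n + 1) * (n + 1)) * M.lawDeg ^ (n + 1) * C_G * (n + 1).factorial * (D ^ r' * D ^ (m₀ - 1)) := by
          gcongr
      _ = 2 ^ ((n + 1) * (n + 1)) * M.lawDeg ^ (n + 1) * C_G * (n + 1).factorial * D ^ n := by rw [h4]
  -- assemble
  rw [hncard]
  calc (T + s).choose s * 𝓨.card * ρ * D ^ (m₀ - 1)
      = (𝓨.card * ((T + s).choose s * ρ)) * D ^ (m₀ - 1) := by ring
    _ = (∑ Y ∈ (Finset.univ : Finset ↥𝓨), (T + s).choose s * ρ) * D ^ (m₀ - 1) := by rw [hcard]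
    _ ≤ (Kb * m₀.factorial) * D ^ (m₀ - 1) := Nat.mul_le_mul_right _ hsum
    _ ≤ 2 ^ ((n + 1) * (n + 1)) * M.lawDeg ^ (n + 1) * C_G * (n + 1).factorial * D ^ n := hconst

end AnalyticGroupModel

end Literature.NumberTheory.Transcendental
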